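import Summits.CriticalPhenomena.PercolationContinuityZ3.Theorems.PercNearOneGluingNoHeavyLowerTailStarSetClassWordsMulti
import HarnessLib

/-!
# `NoHeavyLowerTail` (stmt-CriticalPhenomena-4575) — the class-word budget: distinct class-words have disjoint pattern sets (blueprint §A (R2))

Support file (prover `prim-gen-swap` gen 13; `--supports stmt-CriticalPhenomena-4575`).  No definitions, no named facts, no sorries.

Star level.  Stars `i : Fin m` in classes `cls i : κ` with class ports `P, P' : κ → V`; a hair pattern `e : Fin m → Fin 3` glues star `i` to
`P (cls i)` (`e i = 1`), to `P' (cls i)` (`e i = 2`) or not at all (`e i = 0`); its designated port set is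
`R_e = {P (cls i) : e i = 1} ∪ {P' (cls i) : e i = 2}`.  A CLASS-WORD is `(T, δ)` with `T : Finset κ` and `δ : κ → Bool` (`true` ↦ `P`,
`false` ↦ `P'`), `δ = false` off `T`; its pattern set `Pat(T,δ)` (the filter of `sum_patterns_classWord_eq`, p213744) consists of the patterns
gluing no star outside `T`, gluing the stars of `X ∈ T` only to the port `δ X`, at least one per class.  These sets are the fibres of the map
`e ↦ (classes with a glued star, [some star of the class glued to P])` restricted to the patterns whose glued stars agree within each class;
on `Pat(T,δ)` the designated port set is `T.image (port δ)`.  Hence, for nonnegative coefficients, the total mass of all VALID class-words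
(≥ 3 distinct designated ports, none equal to `r`) is at most the budget `Σ_{e : r ∉ R_e, 3 ≤ #R_e} coef e` (= κ₃(r) of U1-PROOF.md).

* `StarSet.classWord_patterns_eq_fibre` — `Pat(T,δ)` as a fibre;
* `StarSet.designated_ports_of_good` — `R_e = T_e.image (port δ_e)` for patterns whose glued stars agree within classes;
* `StarSet.classWords_budget_le` — `Σ_{valid (T,δ)} Σ_{e ∈ Pat(T,δ)} coef e ≤ Σ_{e : r ∉ R_e} [3 ≤ #R_e]·coef e`.
-/

namespace Summit.CriticalPhenomena.PercolationContinuityZ3.Theorems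

open Finset
open scoped BigOperators

namespace StarSet

variable {m : ℕ} {κ V : Type*} [Fintype κ] [DecidableEq κ] [DecidableEq V]

/-- The pattern set of the class-word `(T, δ)` is the fibre over `(T, δ)` of `e ↦ (T_e, δ_e)` among the patterns whose glued stars agree
within each class (`δ` canonical: `false` off `T`). -/
theorem classWord_patterns_eq_fibre (cls : Fin m → κ) (T : Finset κ) (δ : κ → Bool) (hδ : ∀ X ∉ T, δ X = false) :
    (univ : Finset (Fin m → Fin 3)).filter (fun e =>
        (∀ i, cls i ∉ T → e i = 0) ∧ (∀ i, cls i ∈ T → (e i = 0 ∨ e i = (if δ (cls i) then 1 else 2))) ∧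
          (∀ X ∈ T, ∃ i, cls i = X ∧ e i ≠ 0)) =
      (univ : Finset (Fin m → Fin 3)).filter (fun e =>
        (∀ i j, cls i = cls j → e i ≠ 0 → e j ≠ 0 → e i = e j) ∧
          (univ.filter (fun i => e i ≠ 0)).image cls = T ∧
            (fun X => decide (∃ i, cls i = X ∧ e i = 1)) = δ) := by
  ext e
  simp only [mem_filter, mem_univ, true_and]
  constructor
  · rintro ⟨hout, hin, hglued⟩
    have hval : ∀ i, e i ≠ 0 → cls i ∈ T ∧ e i = (if δ (cls i) then 1 else 2) := by
      intro i hi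
      have hT : cls i ∈ T := by
        by_contra h; exact hi (hout i h)
      exact ⟨hT, (hin i hT).resolve_left hi⟩
    refine ⟨?_, ?_, ?_⟩
    · intro i j hij hi hj
      rw [(hval i hi).2, (hval j hj).2, hij]
    · ext X
      simp only [mem_image, mem_filter, mem_univ, true_and]
      constructor
      · rintro ⟨i, hi, rfl⟩; exact (hval i hi).1
      · intro hX
        obtain ⟨i, hi, hne⟩ := hglued X hX
        exact ⟨i, hne, hi⟩
    · funext X
      by_cases hX : X ∈ T
      · obtain ⟨i, hi, hne⟩ := hglued X hX
        have h2 := (hval i hne).2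
        rw [hi] at h2
        cases hd : δ X
        · rw [hd] at h2
          simp only [Bool.false_eq_true, ↓reduceIte] at h2
          rw [decide_eq_false_iff_not]
          rintro ⟨j, hj, hj1⟩
          have := (hval j (by rw [hj1]; decide)).2
          rw [hj, hd] at this
          simp only [Bool.false_eq_true, ↓reduceIte] at this
          rw [hj1] at this
          exact absurd this (by decide)
        · rw [hd] at h2
          simp only [↓reduceIte] at h2
          rw [decide_eq_true_iff]
          exact ⟨i, hi, h2⟩
      · rw [hδ X hX, decide_eq_false_iff_not]
        rintro ⟨j, hj, hj1⟩
        exact absurd (hout j (hj ▸ hX)) (by rw [hj1]; decide)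
  · rintro ⟨hgood, hT, hδe⟩
    have hmemT : ∀ i, e i ≠ 0 → cls i ∈ T := fun i hi => by
      rw [← hT]; exact mem_image_of_mem cls (mem_filter.2 ⟨mem_univ _, hi⟩)
    refine ⟨fun i hi => by by_contra h; exact hi (hmemT i h), fun i hi => ?_, fun X hX => ?_⟩
    · by_cases h0 : e i = 0
      · exact Or.inl h0
      · right
        have hδX : δ (cls i) = decide (∃ j, cls j = cls i ∧ e j = 1) := by rw [← hδe]
        by_cases h1 : e i = 1
        · have : δ (cls i) = true := by rw [hδX, decide_eq_true_iff]; exact ⟨i, rfl, h1⟩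
          rw [this]; simpa using h1
        · have h2 : e i = 2 := by
            rcases h : e i with ⟨val, hv⟩
            rw [h] at h0 h1
            interval_cases val
            · exact absurd rfl h0
            · exact absurd rfl h1
            · rfl
          have : δ (cls i) = false := by
            rw [hδX, decide_eq_false_iff_not]
            rintro ⟨j, hj, hj1⟩
            have := hgood j i hj (by rw [hj1]; decide) h0
            rw [hj1, h2] at this
            exact absurd this (by decide)
          rw [this]; simpa using h2
    · rw [← hT] at hX
      obtain ⟨i, hi, rfl⟩ := mem_image.1 hX
      exact ⟨i, rfl, (mem_filter.1 hi).2⟩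

omit [Fintype κ] in
/-- For a pattern whose glued stars agree within each class, the designated port set is the image of its classes under its designation. -/
theorem designated_ports_of_good (cls : Fin m → κ) (P P' : κ → V) (p p' : Fin m → V) (hP : ∀ i, p i = P (cls i))
    (hP' : ∀ i, p' i = P' (cls i)) (e : Fin m → Fin 3) (hgood : ∀ i j, cls i = cls j → e i ≠ 0 → e j ≠ 0 → e i = e j) :
    (univ.filter fun i => e i = 1).image p ∪ (univ.filter fun i => e i = 2).image p' =
      ((univ.filter (fun i => e i ≠ 0)).image cls).image
        (fun X => if decide (∃ i, cls i = X ∧ e i = 1) then P X else P' X) := by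
  ext v
  simp only [mem_union, mem_image, mem_filter, mem_univ, true_and]
  constructor
  · rintro (⟨i, hi, rfl⟩ | ⟨i, hi, rfl⟩)
    · refine ⟨cls i, ⟨i, by rw [hi]; decide, rfl⟩, ?_⟩
      have : decide (∃ j, cls j = cls i ∧ e j = 1) = true := by rw [decide_eq_true_iff]; exact ⟨i, rfl, hi⟩
      rw [this]; simp [hP i]
    · refine ⟨cls i, ⟨i, by rw [hi]; decide, rfl⟩, ?_⟩
      have : decide (∃ j, cls j = cls i ∧ e j = 1) = false := by
        rw [decide_eq_false_iff_not]
        rintro ⟨j, hj, hj1⟩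
        have := hgood j i hj (by rw [hj1]; decide) (by rw [hi]; decide)
        rw [hj1, hi] at this
        exact absurd this (by decide)
      rw [this]; simp [hP' i]
  · rintro ⟨X, ⟨i, hi, rfl⟩, rfl⟩
    by_cases hex : ∃ j, cls j = cls i ∧ e j = 1
    · obtain ⟨j, hj, hj1⟩ := hex
      have : decide (∃ j, cls j = cls i ∧ e j = 1) = true := by rw [decide_eq_true_iff]; exact ⟨j, hj, hj1⟩
      rw [this]
      exact Or.inl ⟨j, hj1, by simp [hP j, hj]⟩
    · have : decide (∃ j, cls j = cls i ∧ e j = 1) = false := by rw [decide_eq_false_iff_not]; exact hex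
      rw [this]
      have h2 : e i = 2 := by
        have h1 : e i ≠ 1 := fun h => hex ⟨i, rfl, h⟩
        have : (e i).val < 3 := (e i).isLt
        rcases h : e i with ⟨val, hv⟩
        rw [h] at hi h1
        interval_cases val
        · exact absurd rfl hi
        · exact absurd rfl h1
        · rfl
      exact Or.inr ⟨i, h2, by simp [hP' i]⟩

/-- **The class-word budget (blueprint §A (R2)): `Σ_{valid (T,δ)} mass(T,δ) ≤ Σ_{e : r ∉ R_e} [3 ≤ #R_e]·coef e`** for nonnegative coefficients. -/
theorem classWords_budget_le {n : ℕ} (cls : Fin m → κ) (P P' : κ → Fin n) (p p' : Fin m → Fin n) (hP : ∀ i, p i = P (cls i))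
    (hP' : ∀ i, p' i = P' (cls i)) (r : Fin n) (c : Fin m → Fin 3 → ℝ) (hc : ∀ i k, 0 ≤ c i k) :
    ∑ w ∈ ((univ : Finset (Finset κ)) ×ˢ (univ : Finset (κ → Bool))).filter (fun w =>
        (∀ X ∉ w.1, w.2 X = false) ∧ 3 ≤ (w.1.image fun X => if w.2 X then P X else P' X).card ∧
          r ∉ w.1.image fun X => if w.2 X then P X else P' X),
      ∑ e ∈ (univ : Finset (Fin m → Fin 3)).filter (fun e =>
        (∀ i, cls i ∉ w.1 → e i = 0) ∧ (∀ i, cls i ∈ w.1 → (e i = 0 ∨ e i = (if w.2 (cls i) then 1 else 2))) ∧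
          (∀ X ∈ w.1, ∃ i, cls i = X ∧ e i ≠ 0)),
        ∏ i, c i (e i) ≤
      ∑ e ∈ (univ : Finset (Fin m → Fin 3)).filter (fun e =>
          r ∉ (univ.filter fun i => e i = 1).image p ∪ (univ.filter fun i => e i = 2).image p'),
        (if 3 ≤ ((univ.filter fun i => e i = 1).image p ∪ (univ.filter fun i => e i = 2).image p').card then
          ∏ i, c i (e i) else 0) := by
  classical
  set Words := ((univ : Finset (Finset κ)) ×ˢ (univ : Finset (κ → Bool))).filter (fun w =>
        (∀ X ∉ w.1, w.2 X = false) ∧ 3 ≤ (w.1.image fun X => if w.2 X then P X else P' X).card ∧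
          r ∉ w.1.image fun X => if w.2 X then P X else P' X) with hWords
  set good := (univ : Finset (Fin m → Fin 3)).filter (fun e => ∀ i j, cls i = cls j → e i ≠ 0 → e j ≠ 0 → e i = e j) with hgood
  set wordOf : (Fin m → Fin 3) → Finset κ × (κ → Bool) := fun e =>
    ((univ.filter (fun i => e i ≠ 0)).image cls, fun X => decide (∃ i, cls i = X ∧ e i = 1)) with hwordOf
  -- rewrite each inner sum as a fibre of `wordOf` inside `good`
  have hfib : ∀ w ∈ Words, (univ : Finset (Fin m → Fin 3)).filter (fun e =>
        (∀ i, cls i ∉ w.1 → e i = 0) ∧ (∀ i, cls i ∈ w.1 → (e i = 0 ∨ e i = (if w.2 (cls i) then 1 else 2))) ∧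
          (∀ X ∈ w.1, ∃ i, cls i = X ∧ e i ≠ 0)) = good.filter (fun e => wordOf e = w) := by
    intro w hw
    have hδ : ∀ X ∉ w.1, w.2 X = false := (mem_filter.1 hw).2.1
    rw [classWord_patterns_eq_fibre cls w.1 w.2 hδ, hgood, filter_filter]
    refine filter_congr fun e _ => ?_
    simp only [hwordOf, Prod.ext_iff]
  rw [sum_congr rfl fun w hw => by rw [hfib w hw]]
  -- the fibres over `Words` form the subset `{e ∈ good | wordOf e ∈ Words}`
  rw [sum_fiberwise_eq_sum_filter]
  have hR : ∀ e ∈ good.filter (fun e => wordOf e ∈ Words),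
      (univ.filter fun i => e i = 1).image p ∪ (univ.filter fun i => e i = 2).image p' =
        (wordOf e).1.image (fun X => if (wordOf e).2 X then P X else P' X) := by
    intro e he
    have hg : ∀ i j, cls i = cls j → e i ≠ 0 → e j ≠ 0 → e i = e j := (mem_filter.1 (mem_filter.1 he).1).2
    exact designated_ports_of_good cls P P' p p' hP hP' e hg
  calc ∑ e ∈ good.filter (fun e => wordOf e ∈ Words), ∏ i, c i (e i)
      = ∑ e ∈ good.filter (fun e => wordOf e ∈ Words),
          (if 3 ≤ ((univ.filter fun i => e i = 1).image p ∪ (univ.filter fun i => e i = 2).image p').card then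
            ∏ i, c i (e i) else 0) := by
        refine sum_congr rfl fun e he => ?_
        have hw : wordOf e ∈ Words := (mem_filter.1 he).2
        obtain ⟨-, h3, -⟩ := (mem_filter.1 hw).2
        rw [if_pos (by rw [hR e he]; exact h3)]
    _ ≤ _ := by
        refine sum_le_sum_of_subset_of_nonneg (fun e he => ?_) (fun e _ _ => ?_)
        · have hw : wordOf e ∈ Words := (mem_filter.1 he).2
          obtain ⟨-, -, hr⟩ := (mem_filter.1 hw).2
          rw [mem_filter, hR e he]
          exact ⟨mem_univ _, hr⟩
        · split_ifs
          · exact prod_nonneg fun i _ => hc i (e i)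
          · exact le_rfl

end StarSet

end Summit.CriticalPhenomena.PercolationContinuityZ3.Theorems
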